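import Summits.CriticalPhenomena.PercolationContinuityZ3.Theorems.PercNearOneGluingNoHeavyQuantHoeffdingPotential
import HarnessLib

/-!
# QUANT lane R8, T-DEC: HOEFFDING'S THREE-VALUE REDUCTION, part 2 — every Poisson-binomial law is an exact mixture of the laws of
# THREE-VALUED gate vectors `(1,…,1, g,…,g, 0,…,0)` of the same width and gate sum (prim-quant-census-2 gen 83, file 2/3)

builds on p205010 (kernel theorem, internal audit signed; external expert review pending)

Support file (`--supports stmt-CriticalPhenomena-4575`), QUANT lane census seat prim-quant-census-2 (gen 83); memo
`run/shared/lean/prim/quant/prim-quant-census-2-g83/HOEFFDING-G83.md`.  Theorems only, standard axioms, no sorries, no definitions.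

With the pair identity and the potential of `…QuantHoeffdingPotential` (file 1/3): choosing `(a₁,b₁) = (m̄, a+b−m̄)` and `(a₂,b₂) = (0, a+b)`
(`a + b ≤ 1`) or `(1, a+b−1)` (`a + b > 1`) for interior gates `a < m̄ < b` gives a genuine mixture (`θ ∈ [0,1]` because
`m̄(a+b−m̄) − ab = (m̄−a)(b−m̄) > 0`, `ab ≥ 0`, `ab − (a+b−1) = (1−a)(1−b) > 0`); both lists have the same width and gate sum and a smaller
potential, and the recursion stops at lists all of whose interior gates are equal — THREE-VALUED lists:
* `mix3_of_bad_nil` (terminal lists), `mix3_combine` (two mixtures combine along the pair identity), `mix3_of_pot_le` (strong induction on the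
  potential).
* **`blobLaw_threeValued_mixture`** — for every gate list `G ⊂ [0,1]` there are finitely many gate lists `F_i ⊂ {0, g_i, 1}` (`0 < g_i < 1`) with
  `|F_i| = |G|`, `ΣF_i = ΣG`, and convex weights `λ_i`, such that `blobLaw (G.map (k,·)) = Σ_i λ_i · blobLaw (F_i.map (k,·))` pointwise for EVERY
  common blob size `k`.  This is the mixture form of the three-value reduction behind [cite: Hoeffding1956, Theorem 5] (there: extrema of
  `E f(S)` at fixed `ES`); here an exact identity of laws, from which the extremal statement for any linear functional of the law follows.
  Consumed by `…QuantThreeValuedReduction` (file 3/3): conjecture BLOB-AFL for ARBITRARY gate vectors reduces to "`r` equal blobs, target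
  lowered by `m` ones".

HONEST STATUS.  Tool only; conjecture BLOB-AFL in the middle band beyond width 4, conjecture C, `SiblingStep`, `FarTreeRow`, `GluedLemmaW`,
`GluedDominatedMass` OPEN; RATE class (log\*) / honest sentence of `run/shared/lean/prim/quant/README.md` unchanged.  [this work].  The
three-value phenomenon is classical [cite: Hoeffding1956, Theorem 5] (extrema of `E f(S)` at fixed `ES` over independent trials are attained at
gate vectors with at most one value outside `{0,1}`); it is NOT used as a cited fact — everything here is proved from the definitions.  The gluing
rows served [cite: KozmaNitzan2024, Conjecture 3 (p. 15)]; product measure [cite: Grimmett1999, §1.3 p. 10].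
-/

noncomputable section

open scoped BigOperators

namespace Summit.CriticalPhenomena.PercolationContinuityZ3.Theorems
namespace Quant

open Finset

/-- the blob list of a gate list at the common blob size `k` -/
local notation3 "BL[" k ", " G "]" => LawDec.blobLaw (List.map (fun g : ℝ => ((k : ℕ), g)) G)

/-- the gates of `G` lying strictly inside `(0,1)` -/
local notation3 "INT[" G "]" => List.filter (fun x : ℝ => decide (0 < x ∧ x < 1)) (G : List ℝ)

/-- the mean of the interior gates of `G` -/
local notation3 "IMEAN[" G "]" => (List.sum INT[G]) / ((List.length INT[G] : ℕ) : ℝ)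

/-- the interior gates of `G` different from their mean -/
local notation3 "BAD[" G "]" => List.filter (fun x : ℝ => decide (x ≠ IMEAN[G])) INT[G]

/-- the potential `(|G|+1)·#interior + #(interior ≠ mean)` -/
local notation3 "POT[" G "]" => ((List.length (G : List ℝ)) + 1) * List.length INT[G] + List.length BAD[G]

/-- `G` is an exact mixture of three-valued gate lists of the same width and gate sum, for every common blob size -/
local notation3 "MIX3[" G "]" =>
  ∃ (ι : Type) (_ : Fintype ι) (lam : ι → ℝ) (F : ι → List ℝ),
    (∀ i, 0 ≤ lam i) ∧ (∑ i, lam i = 1) ∧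
    (∀ i, (F i).length = (G : List ℝ).length ∧ (F i).sum = (G : List ℝ).sum ∧ (∀ x ∈ F i, 0 ≤ x ∧ x ≤ 1) ∧
      (∃ g : ℝ, 0 < g ∧ g < 1 ∧ ∀ x ∈ F i, x = 0 ∨ x = 1 ∨ x = g)) ∧
    (∀ (k : ℕ) (h : ℕ), BL[k, G] h = ∑ i, lam i * BL[k, F i] h)

namespace LawDec

/-! ### 6. Terminal lists and the combination of two mixtures -/

/-- **TERMINAL LISTS.**  If every interior gate equals the interior mean, `G` is itself three-valued: the trivial mixture. [this work] -/
theorem mix3_of_bad_nil (G : List ℝ) (hG : ∀ g ∈ G, 0 ≤ g ∧ g ≤ 1) (hbad : BAD[G] = []) : MIX3[G] := by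
  classical
  have hval : ∃ g : ℝ, 0 < g ∧ g < 1 ∧ ∀ x ∈ G, x = 0 ∨ x = 1 ∨ x = g := by
    by_cases hne : INT[G] = []
    · refine ⟨1 / 2, by norm_num, by norm_num, fun x hx => ?_⟩
      have hx' := hG x hx
      have hnot : ¬ (0 < x ∧ x < 1) := fun h => by
        have : x ∈ INT[G] := (mem_int_iff G x).2 ⟨hx, h⟩
        rw [hne] at this; simp at this
      rcases hx'.1.eq_or_lt with h0 | h0
      · exact Or.inl h0.symm
      · refine Or.inr (Or.inl ?_)
        by_contra h1
        exact hnot ⟨h0, lt_of_le_of_ne hx'.2 h1⟩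
    · obtain ⟨hm0, hm1⟩ := imean_mem G hne
      refine ⟨IMEAN[G], hm0, hm1, fun x hx => ?_⟩
      have hx' := hG x hx
      by_cases hint : 0 < x ∧ x < 1
      · refine Or.inr (Or.inr ?_)
        by_contra hne'
        have : x ∈ BAD[G] := by
          rw [List.mem_filter, decide_eq_true_eq]; exact ⟨(mem_int_iff G x).2 ⟨hx, hint⟩, hne'⟩
        rw [hbad] at this; simp at this
      · rcases hx'.1.eq_or_lt with h0 | h0
        · exact Or.inl h0.symm
        · refine Or.inr (Or.inl ?_)
          by_contra h1
          exact hint ⟨h0, lt_of_le_of_ne hx'.2 h1⟩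
  exact ⟨Unit, inferInstance, fun _ => 1, fun _ => G, fun _ => zero_le_one, by simp, fun _ => ⟨rfl, rfl, hG, hval⟩,
    fun k h => by simp⟩

/-- **COMBINATION.**  If `P_G = θ·P_{G₁} + (1−θ)·P_{G₂}` for every blob size, `G₁, G₂` have the width and gate sum of `G`, and both are
mixtures of three-valued lists, so is `G`. [this work] -/
theorem mix3_combine (G G₁ G₂ : List ℝ) (θ : ℝ) (hθ0 : 0 ≤ θ) (hθ1 : θ ≤ 1) (hl₁ : G₁.length = G.length)
    (hl₂ : G₂.length = G.length) (hs₁ : G₁.sum = G.sum) (hs₂ : G₂.sum = G.sum)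
    (hlaw : ∀ (k : ℕ) (h : ℕ), BL[k, G] h = θ * BL[k, G₁] h + (1 - θ) * BL[k, G₂] h)
    (h₁ : MIX3[G₁]) (h₂ : MIX3[G₂]) : MIX3[G] := by
  obtain ⟨ι₁, hι₁, lam₁, F₁, h10, h11, hF₁, hL₁⟩ := h₁
  obtain ⟨ι₂, hι₂, lam₂, F₂, h20, h21, hF₂, hL₂⟩ := h₂
  refine ⟨ι₁ ⊕ ι₂, inferInstance, Sum.elim (fun i => θ * lam₁ i) (fun i => (1 - θ) * lam₂ i), Sum.elim F₁ F₂,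
    ?_, ?_, ?_, fun k h => ?_⟩
  · rintro (i | i)
    · exact mul_nonneg hθ0 (h10 i)
    · exact mul_nonneg (by linarith) (h20 i)
  · rw [Fintype.sum_sum_type]
    simp only [Sum.elim_inl, Sum.elim_inr]
    rw [← Finset.mul_sum, ← Finset.mul_sum, h11, h21]
    ring
  · rintro (i | i)
    · obtain ⟨e1, e2, e3, e4⟩ := hF₁ i
      exact ⟨e1.trans hl₁, e2.trans hs₁, e3, e4⟩
    · obtain ⟨e1, e2, e3, e4⟩ := hF₂ i
      exact ⟨e1.trans hl₂, e2.trans hs₂, e3, e4⟩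
  · rw [hlaw k h, hL₁ k h, hL₂ k h, Fintype.sum_sum_type]
    simp only [Sum.elim_inl, Sum.elim_inr]
    rw [Finset.mul_sum, Finset.mul_sum]
    congr 1
    · exact Finset.sum_congr rfl fun i _ => by ring
    · exact Finset.sum_congr rfl fun i _ => by ring
/-! ### 7. The recursion -/

/-- the three-value recursion, by strong induction on the potential. [this work] -/
theorem mix3_of_pot_le (N : ℕ) : ∀ G : List ℝ, (∀ g ∈ G, 0 ≤ g ∧ g ≤ 1) → POT[G] ≤ N → MIX3[G] := by
  induction N with
  | zero =>
    intro G hG hP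
    exact mix3_of_bad_nil G hG (List.eq_nil_of_length_eq_zero (Nat.eq_zero_of_le_zero ((Nat.le_add_left _ _).trans hP)))
  | succ N ih =>
    intro G hG hP
    classical
    by_cases hbad : BAD[G] = []
    · exact mix3_of_bad_nil G hG hbad
    obtain ⟨a, b, haG, hbG, ha0, ham, hmb, hb1⟩ := exists_pair_around_imean G hbad
    -- bring `a, b` to the front
    have hba : b ≠ a := (ham.trans hmb).ne'
    have hbG' : b ∈ G.erase a := (List.mem_erase_of_ne hba).2 hbG
    set W := (G.erase a).erase b with hW
    have hperm : G.Perm (a :: b :: W) := (List.perm_cons_erase haG).trans ((List.perm_cons_erase hbG').cons a)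
    obtain ⟨hmeanP, hpotP⟩ := pot_perm hperm
    rw [hmeanP] at ham hmb
    set m := IMEAN[a :: b :: W] with hm
    have hWg : ∀ g ∈ W, 0 ≤ g ∧ g ≤ 1 := fun g hg => hG g (hperm.symm.subset (by simp [hg]))
    have ha : 0 < a ∧ a < 1 := ⟨ha0, by linarith⟩
    have hb : 0 < b ∧ b < 1 := ⟨by linarith, hb1⟩
    -- the equalized list
    set G₁ := m :: (a + b - m) :: W with hG₁
    have hG₁g : ∀ g ∈ G₁, 0 ≤ g ∧ g ≤ 1 := by
      intro g hg
      simp only [hG₁, List.mem_cons] at hg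
      rcases hg with rfl | rfl | hg
      · exact ⟨by linarith, by linarith⟩
      · exact ⟨by linarith, by linarith⟩
      · exact hWg g hg
    have hP₁ : POT[G₁] < POT[G] := by rw [hpotP]; exact pot_equalize_lt a b W ha0 hb1 ham hmb
    have hmix₁ : MIX3[G₁] := ih G₁ hG₁g (Nat.lt_succ_iff.1 (lt_of_lt_of_le hP₁ hP))
    have hlen₁ : G₁.length = G.length := by rw [hperm.length_eq]; simp [hG₁]
    have hsum₁ : G₁.sum = G.sum := by rw [hperm.sum_eq]; simp only [hG₁, List.sum_cons]; ring
    -- the gate products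
    have ht₁ : a * b < m * (a + b - m) := by nlinarith
    have hlawG : ∀ (k : ℕ) (h : ℕ), BL[k, G] h = blobLaw ((k, a) :: (k, b) :: List.map (fun g : ℝ => (k, g)) W) h := by
      intro k h
      rw [congrFun (blobLaw_perm (hperm.map (fun g : ℝ => (k, g)))) h]
      rfl
    by_cases hc : a + b ≤ 1
    · -- boundary list `(0, a + b)`
      set G₂ := (0 : ℝ) :: (a + b) :: W with hG₂
      have hG₂g : ∀ g ∈ G₂, 0 ≤ g ∧ g ≤ 1 := by
        intro g hg
        simp only [hG₂, List.mem_cons] at hg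
        rcases hg with rfl | rfl | hg
        · exact ⟨le_rfl, zero_le_one⟩
        · exact ⟨by linarith, hc⟩
        · exact hWg g hg
      have hP₂ : POT[G₂] < POT[G] := by
        rw [hpotP]; exact pot_boundary_lt a b 0 (a + b) W ha hb (fun h => lt_irrefl _ h.1)
      have hmix₂ : MIX3[G₂] := ih G₂ hG₂g (Nat.lt_succ_iff.1 (lt_of_lt_of_le hP₂ hP))
      have hlen₂ : G₂.length = G.length := by rw [hperm.length_eq]; simp [hG₂]
      have hsum₂ : G₂.sum = G.sum := by rw [hperm.sum_eq]; simp only [hG₂, List.sum_cons]; ring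
      have ht₁pos : 0 < m * (a + b - m) := lt_trans (mul_pos ha.1 hb.1) ht₁
      set θ := a * b / (m * (a + b - m)) with hθ
      have hp : a * b = θ * (m * (a + b - m)) + (1 - θ) * (0 * (a + b)) := by
        rw [hθ, zero_mul, mul_zero, add_zero, div_mul_cancel₀ _ ht₁pos.ne']
      refine mix3_combine G G₁ G₂ θ (div_nonneg (mul_pos ha.1 hb.1).le ht₁pos.le) ((div_le_one ht₁pos).2 ht₁.le)
        hlen₁ hlen₂ hsum₁ hsum₂ (fun k h => ?_) hmix₁ hmix₂
      rw [hlawG k h]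
      exact blobLaw_pair_mix k a b m (a + b - m) 0 (a + b) θ _ (by ring) (by ring) hp h
    · -- boundary list `(1, a + b − 1)`
      have hc : 1 < a + b := lt_of_not_ge hc
      set G₂ := (1 : ℝ) :: (a + b - 1) :: W with hG₂
      have hG₂g : ∀ g ∈ G₂, 0 ≤ g ∧ g ≤ 1 := by
        intro g hg
        simp only [hG₂, List.mem_cons] at hg
        rcases hg with rfl | rfl | hg
        · exact ⟨zero_le_one, le_rfl⟩
        · exact ⟨by linarith, by linarith⟩
        · exact hWg g hg
      have hP₂ : POT[G₂] < POT[G] := by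
        rw [hpotP]; exact pot_boundary_lt a b 1 (a + b - 1) W ha hb (fun h => lt_irrefl _ h.2)
      have hmix₂ : MIX3[G₂] := ih G₂ hG₂g (Nat.lt_succ_iff.1 (lt_of_lt_of_le hP₂ hP))
      have hlen₂ : G₂.length = G.length := by rw [hperm.length_eq]; simp [hG₂]
      have hsum₂ : G₂.sum = G.sum := by rw [hperm.sum_eq]; simp only [hG₂, List.sum_cons]; ring
      have ht₂ : 1 * (a + b - 1) < a * b := by nlinarith
      have hd : 0 < m * (a + b - m) - 1 * (a + b - 1) := by linarith
      set θ := (a * b - 1 * (a + b - 1)) / (m * (a + b - m) - 1 * (a + b - 1)) with hθ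
      have key : θ * (m * (a + b - m) - 1 * (a + b - 1)) = a * b - 1 * (a + b - 1) := by
        rw [hθ]; exact div_mul_cancel₀ _ hd.ne'
      have hp : a * b = θ * (m * (a + b - m)) + (1 - θ) * (1 * (a + b - 1)) := by
        calc a * b = 1 * (a + b - 1) + (a * b - 1 * (a + b - 1)) := by ring
          _ = 1 * (a + b - 1) + θ * (m * (a + b - m) - 1 * (a + b - 1)) := by rw [key]
          _ = θ * (m * (a + b - m)) + (1 - θ) * (1 * (a + b - 1)) := by ring
      refine mix3_combine G G₁ G₂ θ (div_nonneg (by linarith) hd.le) ((div_le_one hd).2 (by linarith))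
        hlen₁ hlen₂ hsum₁ hsum₂ (fun k h => ?_) hmix₁ hmix₂
      rw [hlawG k h]
      exact blobLaw_pair_mix k a b m (a + b - m) 1 (a + b - 1) θ _ (by ring) (by ring) hp h

/-- **HOEFFDING'S THREE-VALUE REDUCTION, MIXTURE FORM.**  For every gate list `G ⊂ [0,1]` there are finitely many THREE-VALUED gate lists
`F_i ⊂ {0, g_i, 1}` (`0 < g_i < 1`) of the same width and the same gate sum, and convex weights `λ_i`, with
`blobLaw (G.map (k,·)) = Σ_i λ_i · blobLaw (F_i.map (k,·))` pointwise, for every common blob size `k`: the Poisson-binomial law of `G` is an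
exact mixture of "`m` ones + Binomial(`r`, `g`)" laws.  (The extremal statement [cite: Hoeffding1956, Theorem 5] follows: a linear functional of
the law is extremised at a three-valued gate vector.) [this work] -/
theorem blobLaw_threeValued_mixture (G : List ℝ) (hG : ∀ g ∈ G, 0 ≤ g ∧ g ≤ 1) : MIX3[G] :=
  mix3_of_pot_le _ G hG le_rfl

end LawDec
end Quant
end Summit.CriticalPhenomena.PercolationContinuityZ3.Theorems
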